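import Summits.Schanuel.Schanuel.Theorems.RootDecomp1BProductCell06

/-!
# RootDecomp1BProductCell — lens 4, generation 46 «PRODUCT CELL: TWO INDEPENDENT LIOUVILLE COORDINATES VIA THE QUANTITATIVE STOREY-ONE CELL» (CLAIM L2339, PRICE + CHECKLIST B-g46 L2340, NODE L2399 / REQUEST L2400, critic VERDICT L2407: CLEARED — THEOREM ×1 (K1 twoRadical_lower, the composable quantitative engine) + ONE CELL «RATE-MATCHED PRODUCT 𝒜_W × ℬ_W» (K2 algebraicIndependent_product + cells); RULE B-R33; PORT GO) — continuation (RootDecomp1BProductCell07): §7 the cells on the product class and at the named pair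

(lens-4 g46 HOME kernel K = HOME/decomp-schanuel-lens-4/g46/ProductCell.lean d6cd9943…, 1931 l, ONE import …RootDecomp1BTwoRadical05; P/C + NODE-g46.md 601195d2…. Port by census-1 gen 20 as `RootDecomp1BProductCell01–08` from the census CAP EDITION ProductCell.capped.lean (K2 `algebraicIndependent_product` is ONE 398-line declaration block > the 400-line file cap: its step (3) «thrP(N) ≤ exp(c_T q⁴)» — four exponential bounds, context-free — is extracted as the public lemma `thr_le_exp_quartic` in §3c with the local abbreviations passed as variables and the defining equation of c_T as a hypothesis; K2's STATEMENT byte-identical, all 87 K decl signatures identical, +1 decl; farm rc 0 · 0/0/0 · axioms std on K2): 01 = §1 Lipschitz (`FrelC`, `lam`, `lipschitz_Frel₂_explicit`) + §2 root avoidance (`fibreSum_ne_zero`); 02 = §3 K1 `thr`, `bigTheta`, `thrP`, **`twoRadical_lower`**; 03 = §3b outer upper half (`norm_normForm_le`, `normForm_len_le`); 04 = §3c `thr_le`, `thr_le_exp_quartic` (cap lemma) + §4 classes `UltraLiouvilleSW` / `TowerLiouville` («[class] definition» tags) + `thr_nonneg` + §5 prelude `thetaS`; 05 = §5 K2 **`algebraicIndependent_product`**;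 06 = §6 law `sw`, members `ultraLiouvilleSW_rhoU` (tree rhoU), `gT`/`vT`/`tTerm`/`rhoT`/`tNum`/`tRat`, `towerLiouville_rhoT`; 07 = §7 cells `algebraicIndependent_eight_of_pos`, `eight_le_polarDeg_one_pair`, `six_le_polarDeg_one_pair`, `schanuel_body_one_pair`, `six_le_polarDeg_pair`, `four_le_polarDeg_pair`, `schanuel_body_pair`, named pair (ρ_U, ρ_T) hyp-free; 08 = §8 `E₅`, `thrP_le_exp`, `transcMeasure_thetaS`, `transcMeasure_rhoU`. PORT EDITS (VERDICT L2407 (a)–(d) + the cap edition): linter option dropped; 26 one-line docstrings added; class tags in the census wording; scoped heartbeats kept `… in` (1600000 ×2, 800000 ×1 as in K); per-part private helper copies; statements and proofs otherwise verbatim (no renames). `--supports stmt-Schanuel-24622`; no census credit carried; rung 0 — nothing here proves Schanuel; no ∀-item moves.)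
-/

noncomputable section
open Complex
namespace Summit.Schanuel.Schanuel.Theorems.RootDecomp1BProductCell
open MvPolynomial
open Summit.Schanuel.Schanuel.Theorems.RootDecomp1KHyper (mvlen mvlen_nonneg one_le_mvlen abs_coeff_le_mvlen)
open RootDecomp1BRadicalDescent (resFin DExpMeasure UltraLiouville exists_int_relation norm_mvaeval_le_mvlen
  totalDegree_det_le mvlen_det_le adjugate_bounds)
open RootDecomp1BTwoRadical (sX₃ sX₃_apply eq_of_parts₃ Cf₂ Frel₂ Frel₂_eq_aeval radMat₂ det_radMat₂_ne_zero
  det_eq_eigen_mul₂ eigen_eq_Frel₂ mvlen_radMat₂_le totalDegree_radMat₂_le mvlen_Cf₂_le twoRadical_clash)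
variable {n : ℕ}

/-! ## §7 THE CELLS: `t(1, σ, ρ) ≥ 8` and `t(σ, ρ) ≥ 6` on the product class, and at the named pair `(ρ_U, ρ_T)` -/

section Cells

open RootDecomp1BFedFlagCore (polarDeg polarField coe_mem_polarField exp_coe_mem_polarField
  exp_coe_mul_I_mem_polarField)
open RootDecomp1BDefectFloorCells (natCast_le_trdeg_of_algebraicIndependent)
open RootDecomp1BFactDischarge (lwMeasure_holds)
open RootDecomp1BRadicalDescent (isAlgebraic_base linearIndependent_base dExpMeasure_exp_of_LW rhoU rhoU_pos
  ultraLiouville_rhoU)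

/-- `𝒜_W` is symmetric under `σ ↦ −σ`. -/
theorem UltraLiouvilleSW.neg {W : ℕ → ℕ} {σ : ℝ} (h : UltraLiouvilleSW W σ) : UltraLiouvilleSW W (-σ) := by
  intro m
  obtain ⟨Q₀, hQ₀⟩ := h m
  refine ⟨Q₀, fun Q hQ => ?_⟩
  obtain ⟨r, h1, h2, hne, hlt⟩ := hQ₀ Q hQ
  refine ⟨-r, by rwa [Rat.neg_den], by rwa [Rat.neg_den], fun h' => hne ?_, ?_⟩
  · rw [Rat.cast_neg] at h'
    linarith
  · rw [Rat.neg_den, Rat.cast_neg, show -σ - -(r : ℝ) = -(σ - r) by ring, abs_neg]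
    exact hlt

/-- `ℬ_W` is symmetric under `ρ ↦ −ρ`. -/
theorem TowerLiouville.neg {W : ℕ → ℕ} {ρ : ℝ} (h : TowerLiouville W ρ) : TowerLiouville W (-ρ) := by
  intro m
  obtain ⟨r, hm, hne, hlt⟩ := h m
  refine ⟨-r, by rwa [Rat.neg_den], fun h' => hne ?_, ?_⟩
  · rw [Rat.cast_neg] at h'
    linarith
  · rw [Rat.neg_den, Rat.cast_neg, show -ρ - -(r : ℝ) = -(ρ - r) by ring, abs_neg]
    exact hlt

/-- `UltraLiouvilleSW W` is stable under `|·|`. -/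
theorem UltraLiouvilleSW.abs {W : ℕ → ℕ} {σ : ℝ} (h : UltraLiouvilleSW W σ) : UltraLiouvilleSW W |σ| := by
  rcases abs_choice σ with h' | h' <;> rw [h']
  exacts [h, h.neg]

/-- `TowerLiouville W` is stable under `|·|`. -/
theorem TowerLiouville.abs {W : ℕ → ℕ} {ρ : ℝ} (h : TowerLiouville W ρ) : TowerLiouville W |ρ| := by
  rcases abs_choice ρ with h' | h' <;> rw [h']
  exacts [h, h.neg]

/-- **THE PRODUCT-CELL TUPLE (base `(e, e^{i})`).** For `σ ∈ 𝒜_W`, `ρ ∈ ℬ_W` positive, `W` monotone: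
`(e^{ρ}, e^{iρ}, ρ, e^{σ}, e^{iσ}, σ, e, e^{i})` is algebraically independent over `ℚ` — HYPOTHESIS-FREE (the
`DExpMeasure` of `(e, e^{i})` is the tree's Lindemann–Weierstrass measure `lwMeasure_holds` via `dExpMeasure_exp_of_LW`). -/
theorem algebraicIndependent_eight_of_pos {W : ℕ → ℕ} (hW : Monotone W) {σ ρ : ℝ}
    (hσ : UltraLiouvilleSW W σ) (hσ0 : 0 < σ) (hρ : TowerLiouville W ρ) (hρ0 : 0 < ρ) :
    AlgebraicIndependent ℚ
      (Fin.cons (cexp ((ρ : ℂ) * 1)) (Fin.cons (cexp ((ρ : ℂ) * Complex.I)) (Fin.cons (ρ : ℂ)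
        (thetaS (fun i => cexp (![(1 : ℂ), Complex.I] i)) 1 Complex.I σ))) : Fin (2 + 3 + 3) → ℂ) := by
  obtain ⟨A₀, hA₀⟩ := dExpMeasure_exp_of_LW lwMeasure_holds isAlgebraic_base linearIndependent_base
  exact algebraicIndependent_product hA₀ (i₀ := 0) (i₁ := 1) (by decide) (by simp) (by simp) hW hσ hσ0 hρ hρ0

/-- the eight numbers lie in any polar field containing `σ, ρ, e, e^{i}, e^{σ}, e^{iσ}, e^{ρ}, e^{iρ}`. -/
theorem eight_mem_of_mem {F : IntermediateField ℚ ℂ} {σ ρ : ℝ}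
    (hσr : (σ : ℂ) ∈ F) (hρr : (ρ : ℂ) ∈ F) (he : cexp 1 ∈ F) (hei : cexp Complex.I ∈ F)
    (heσ : cexp (σ : ℂ) ∈ F) (heσi : cexp ((σ : ℂ) * Complex.I) ∈ F)
    (heρ : cexp (ρ : ℂ) ∈ F) (heρi : cexp ((ρ : ℂ) * Complex.I) ∈ F) :
    ∀ i, (Fin.cons (cexp ((ρ : ℂ) * 1)) (Fin.cons (cexp ((ρ : ℂ) * Complex.I)) (Fin.cons (ρ : ℂ)
        (thetaS (fun i => cexp (![(1 : ℂ), Complex.I] i)) 1 Complex.I σ))) : Fin (2 + 3 + 3) → ℂ) i ∈ F := by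
  have hθmem : ∀ i, (fun i => cexp (![(1 : ℂ), Complex.I] i)) i ∈ F := by
    intro i
    fin_cases i
    · simpa using he
    · simpa using hei
  intro i
  refine Fin.cases ?_ (fun i => ?_) i
  · simpa using heρ
  · rw [Fin.cons_succ]
    refine Fin.cases ?_ (fun i => ?_) i
    · simpa using heρi
    · rw [Fin.cons_succ]
      refine Fin.cases ?_ (fun i => ?_) i
      · simpa using hρr
      · rw [Fin.cons_succ]
        unfold thetaS
        refine Fin.cases ?_ (fun i => ?_) i
        · simpa using heσ
        · rw [Fin.cons_succ]
          refine Fin.cases ?_ (fun i => ?_) i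
          · simpa using heσi
          · rw [Fin.cons_succ]
            refine Fin.cases ?_ (fun j => ?_) i
            · simpa using hσr
            · rw [Fin.cons_succ]
              exact hθmem j

/-- `|x| ∈ F` when `x ∈ F` (real `x`). -/
private theorem coe_abs_mem {F : IntermediateField ℚ ℂ} {x : ℝ} (h : (x : ℂ) ∈ F) : ((|x| : ℝ) : ℂ) ∈ F := by
  rcases abs_choice x with h' | h' <;> rw [h']
  · exact h
  · push_cast
    exact neg_mem h

/-- `e^{|x|} ∈ F` when `e^x ∈ F` (real `x`). -/
private theorem exp_abs_mem {F : IntermediateField ℚ ℂ} {x : ℝ} (h : cexp (x : ℂ) ∈ F) :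
    cexp ((|x| : ℝ) : ℂ) ∈ F := by
  rcases abs_choice x with h' | h' <;> rw [h']
  · exact h
  · push_cast
    rw [Complex.exp_neg]
    exact inv_mem h

/-- `e^{|x|·y} ∈ F` when `e^{x·y} ∈ F` (real `x`). -/
private theorem exp_abs_mul_mem {F : IntermediateField ℚ ℂ} {x : ℝ} {y : ℂ} (h : cexp ((x : ℂ) * y) ∈ F) :
    cexp (((|x| : ℝ) : ℂ) * y) ∈ F := by
  rcases abs_choice x with h' | h' <;> rw [h']
  · exact h
  · push_cast
    rw [neg_mul, Complex.exp_neg]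
    exact inv_mem h

/-- **`t(r) ≥ 8` (general polar field).** For `σ ∈ 𝒜_W`, `ρ ∈ ℬ_W` (any signs; `W` monotone with `W Q ≥ Q`), every
real tuple `r` whose polar field contains `σ, ρ, e, e^{i}, e^{σ}, e^{iσ}, e^{ρ}, e^{iρ}` has `t(r) ≥ 8` —
HYPOTHESIS-FREE. -/
theorem eight_le_polarDeg_of_mem {W : ℕ → ℕ} (hW : Monotone W) (hWQ : ∀ Q, Q ≤ W Q) {σ ρ : ℝ}
    (hσ : UltraLiouvilleSW W σ) (hρ : TowerLiouville W ρ) {m : ℕ} {r : Fin m → ℝ}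
    (hσr : (σ : ℂ) ∈ polarField r) (hρr : (ρ : ℂ) ∈ polarField r) (he : cexp 1 ∈ polarField r)
    (hei : cexp Complex.I ∈ polarField r) (heσ : cexp (σ : ℂ) ∈ polarField r)
    (heσi : cexp ((σ : ℂ) * Complex.I) ∈ polarField r) (heρ : cexp (ρ : ℂ) ∈ polarField r)
    (heρi : cexp ((ρ : ℂ) * Complex.I) ∈ polarField r) :
    ((8 : ℕ) : Cardinal) ≤ polarDeg r := by
  have hσ0 : σ ≠ 0 := fun h0 => hσ.irrational ⟨0, by simp [h0]⟩
  have hρ0 : ρ ≠ 0 := fun h0 => (hρ.ultraLiouville hWQ).irrational ⟨0, by simp [h0]⟩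
  have hai := algebraicIndependent_eight_of_pos hW hσ.abs (abs_pos.2 hσ0) hρ.abs (abs_pos.2 hρ0)
  exact natCast_le_trdeg_of_algebraicIndependent hai
    (eight_mem_of_mem (coe_abs_mem hσr) (coe_abs_mem hρr) he hei (exp_abs_mem heσ) (exp_abs_mul_mem heσi)
      (exp_abs_mem heρ) (exp_abs_mul_mem heρi))

/-- **THE CELL X(3)⁺. `t(1, σ, ρ) ≥ 8`** for every `σ ∈ 𝒜_W`, `ρ ∈ ℬ_W` — HYPOTHESIS-FREE (no `Roy2014_thm_1_1`, no
measure binder): strictly above the Klein–polar prediction `m + m = 6` of the 1B crux `KleinPolarSchanuel`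
(item 24622) at `m = 3`, `r = (1, σ, ρ)` — the route item's INSTANCE at this `r` is thereby PROVED. -/
theorem eight_le_polarDeg_one_pair {W : ℕ → ℕ} (hW : Monotone W) (hWQ : ∀ Q, Q ≤ W Q) {σ ρ : ℝ}
    (hσ : UltraLiouvilleSW W σ) (hρ : TowerLiouville W ρ) :
    ((8 : ℕ) : Cardinal) ≤ polarDeg ![(1 : ℝ), σ, ρ] :=
  eight_le_polarDeg_of_mem hW hWQ hσ hρ (by simpa using coe_mem_polarField ![(1 : ℝ), σ, ρ] 1)
    (by simpa using coe_mem_polarField ![(1 : ℝ), σ, ρ] 2) (by simpa using exp_coe_mem_polarField ![(1 : ℝ), σ, ρ] 0)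
    (by simpa using exp_coe_mul_I_mem_polarField ![(1 : ℝ), σ, ρ] 0)
    (by simpa using exp_coe_mem_polarField ![(1 : ℝ), σ, ρ] 1)
    (by simpa using exp_coe_mul_I_mem_polarField ![(1 : ℝ), σ, ρ] 1)
    (by simpa using exp_coe_mem_polarField ![(1 : ℝ), σ, ρ] 2)
    (by simpa using exp_coe_mul_I_mem_polarField ![(1 : ℝ), σ, ρ] 2)

/-- The Klein–polar body `m + m ≤ t(r)` of item 24622 at `m = 3`, `r = (1, σ, ρ)`, as a COROLLARY (two to spare). -/
theorem six_le_polarDeg_one_pair {W : ℕ → ℕ} (hW : Monotone W) (hWQ : ∀ Q, Q ≤ W Q) {σ ρ : ℝ}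
    (hσ : UltraLiouvilleSW W σ) (hρ : TowerLiouville W ρ) :
    ((3 + 3 : ℕ) : Cardinal) ≤ polarDeg ![(1 : ℝ), σ, ρ] :=
  (Nat.cast_le.2 (by norm_num)).trans (eight_le_polarDeg_one_pair hW hWQ hσ hρ)

/-- **SCHANUEL'S CONJECTURE AT `z = (1, σ, ρ, i, iσ, iρ)` (`n = 6`)** — the body of `Literature.Periods.SchanuelConjecture`
at this `z`, which is `polarDeg ![1, σ, ρ]` unfolded (the tree's polarDeg ↔ instance bridge, cf.
`RootDecomp1BRadicalDescent.kleinPolarSchanuel_instance_shape`) — PROVED for all `σ ∈ 𝒜_W`, `ρ ∈ ℬ_W`. -/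
theorem schanuel_body_one_pair {W : ℕ → ℕ} (hW : Monotone W) (hWQ : ∀ Q, Q ≤ W Q) {σ ρ : ℝ}
    (hσ : UltraLiouvilleSW W σ) (hρ : TowerLiouville W ρ) :
    ((3 + 3 : ℕ) : Cardinal) ≤ Algebra.trdeg ℚ ↥(IntermediateField.adjoin ℚ
      (Set.range (Fin.append (fun j => ((![(1 : ℝ), σ, ρ] j : ℝ) : ℂ))
          (fun j => ((![(1 : ℝ), σ, ρ] j : ℝ) : ℂ) * Complex.I)) ∪
        Set.range (Complex.exp ∘ Fin.append (fun j => ((![(1 : ℝ), σ, ρ] j : ℝ) : ℂ))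
          (fun j => ((![(1 : ℝ), σ, ρ] j : ℝ) : ℂ) * Complex.I)))) :=
  six_le_polarDeg_one_pair hW hWQ hσ hρ

/-- **THE CELL X(2) WITH NO ALGEBRAIC COORDINATE. `t(σ, ρ) ≥ 6`** for every `σ ∈ 𝒜_W`, `ρ ∈ ℬ_W` — HYPOTHESIS-FREE:
the six numbers `e^{ρ}, e^{iρ}, ρ, e^{σ}, e^{iσ}, σ` (a sub-tuple of the eight) lie in `F(σ, ρ)`. Klein–polar
predicts `m + m = 4`. -/
theorem six_le_polarDeg_pair {W : ℕ → ℕ} (hW : Monotone W) (hWQ : ∀ Q, Q ≤ W Q) {σ ρ : ℝ}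
    (hσ : UltraLiouvilleSW W σ) (hρ : TowerLiouville W ρ) :
    ((6 : ℕ) : Cardinal) ≤ polarDeg ![σ, ρ] := by
  have hσ0 : σ ≠ 0 := fun h0 => hσ.irrational ⟨0, by simp [h0]⟩
  have hρ0 : ρ ≠ 0 := fun h0 => (hρ.ultraLiouville hWQ).irrational ⟨0, by simp [h0]⟩
  have hai := (algebraicIndependent_eight_of_pos hW hσ.abs (abs_pos.2 hσ0) hρ.abs (abs_pos.2 hρ0)).comp
    (Fin.castLE (show 6 ≤ 2 + 3 + 3 by norm_num)) (Fin.castLE_injective _)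
  have hσr : (((|σ| : ℝ)) : ℂ) ∈ polarField ![σ, ρ] := coe_abs_mem (by simpa using coe_mem_polarField ![σ, ρ] 0)
  have hρr : (((|ρ| : ℝ)) : ℂ) ∈ polarField ![σ, ρ] := coe_abs_mem (by simpa using coe_mem_polarField ![σ, ρ] 1)
  have heσ : cexp (((|σ| : ℝ)) : ℂ) ∈ polarField ![σ, ρ] :=
    exp_abs_mem (by simpa using exp_coe_mem_polarField ![σ, ρ] 0)
  have heσi : cexp ((((|σ| : ℝ)) : ℂ) * Complex.I) ∈ polarField ![σ, ρ] :=
    exp_abs_mul_mem (by simpa using exp_coe_mul_I_mem_polarField ![σ, ρ] 0)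
  have heρ : cexp (((|ρ| : ℝ)) : ℂ) ∈ polarField ![σ, ρ] :=
    exp_abs_mem (by simpa using exp_coe_mem_polarField ![σ, ρ] 1)
  have heρi : cexp ((((|ρ| : ℝ)) : ℂ) * Complex.I) ∈ polarField ![σ, ρ] :=
    exp_abs_mul_mem (by simpa using exp_coe_mul_I_mem_polarField ![σ, ρ] 1)
  have hmem : ∀ i : Fin 6, ((Fin.cons (cexp (((|ρ| : ℝ) : ℂ) * 1)) (Fin.cons (cexp (((|ρ| : ℝ) : ℂ) * Complex.I))
      (Fin.cons (((|ρ| : ℝ) : ℂ)) (thetaS (fun i => cexp (![(1 : ℂ), Complex.I] i)) 1 Complex.I |σ|))) :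
        Fin (2 + 3 + 3) → ℂ) ∘ Fin.castLE (show 6 ≤ 2 + 3 + 3 by norm_num)) i ∈ polarField ![σ, ρ] := by
    intro i
    fin_cases i
    · exact (by simpa using heρ : cexp ((((|ρ| : ℝ)) : ℂ) * 1) ∈ polarField ![σ, ρ])
    · exact heρi
    · exact hρr
    · exact (by simpa using heσ : cexp ((((|σ| : ℝ)) : ℂ) * 1) ∈ polarField ![σ, ρ])
    · exact heσi
    · exact hσr
  exact natCast_le_trdeg_of_algebraicIndependent hai hmem

/-- The Klein–polar body of item 24622 at `m = 2`, `r = (σ, ρ)` (prediction `2 + 2`), as a COROLLARY. -/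
theorem four_le_polarDeg_pair {W : ℕ → ℕ} (hW : Monotone W) (hWQ : ∀ Q, Q ≤ W Q) {σ ρ : ℝ}
    (hσ : UltraLiouvilleSW W σ) (hρ : TowerLiouville W ρ) :
    ((2 + 2 : ℕ) : Cardinal) ≤ polarDeg ![σ, ρ] :=
  (Nat.cast_le.2 (by norm_num)).trans (six_le_polarDeg_pair hW hWQ hσ hρ)

/-- **SCHANUEL'S CONJECTURE AT `z = (σ, ρ, iσ, iρ)` (`n = 4`)** — PROVED for all `σ ∈ 𝒜_W`, `ρ ∈ ℬ_W`. -/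
theorem schanuel_body_pair {W : ℕ → ℕ} (hW : Monotone W) (hWQ : ∀ Q, Q ≤ W Q) {σ ρ : ℝ}
    (hσ : UltraLiouvilleSW W σ) (hρ : TowerLiouville W ρ) :
    ((2 + 2 : ℕ) : Cardinal) ≤ Algebra.trdeg ℚ ↥(IntermediateField.adjoin ℚ
      (Set.range (Fin.append (fun j => ((![σ, ρ] j : ℝ) : ℂ)) (fun j => ((![σ, ρ] j : ℝ) : ℂ) * Complex.I)) ∪
        Set.range (Complex.exp ∘ Fin.append (fun j => ((![σ, ρ] j : ℝ) : ℂ))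
          (fun j => ((![σ, ρ] j : ℝ) : ℂ) * Complex.I)))) :=
  four_le_polarDeg_pair hW hWQ hσ hρ

/-! ### The named pair `(ρ_U, ρ_T)` — everything hypothesis-free -/

/-- **`(e^{ρ_T}, e^{iρ_T}, ρ_T, e^{ρ_U}, e^{iρ_U}, ρ_U, e, e^{i})` is algebraically independent over `ℚ`.** -/
theorem algebraicIndependent_eight_rhoU_rhoT :
    AlgebraicIndependent ℚ
      (Fin.cons (cexp ((rhoT : ℂ) * 1)) (Fin.cons (cexp ((rhoT : ℂ) * Complex.I)) (Fin.cons (rhoT : ℂ)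
        (thetaS (fun i => cexp (![(1 : ℂ), Complex.I] i)) 1 Complex.I rhoU))) : Fin (2 + 3 + 3) → ℂ) :=
  algebraicIndependent_eight_of_pos sw_mono ultraLiouvilleSW_rhoU rhoU_pos towerLiouville_rhoT rhoT_pos

/-- **`t(1, ρ_U, ρ_T) ≥ 8`.** -/
theorem eight_le_polarDeg_one_rhoU_rhoT : ((8 : ℕ) : Cardinal) ≤ polarDeg ![(1 : ℝ), rhoU, rhoT] :=
  eight_le_polarDeg_one_pair sw_mono le_sw ultraLiouvilleSW_rhoU towerLiouville_rhoT

/-- **`t(ρ_U, ρ_T) ≥ 6`.** -/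
theorem six_le_polarDeg_rhoU_rhoT : ((6 : ℕ) : Cardinal) ≤ polarDeg ![rhoU, rhoT] :=
  six_le_polarDeg_pair sw_mono le_sw ultraLiouvilleSW_rhoU towerLiouville_rhoT

/-- Schanuel's conjecture at `z = (1, ρ_U, ρ_T, i, iρ_U, iρ_T)` (`n = 6`) — PROVED. -/
theorem schanuel_body_one_rhoU_rhoT :
    ((3 + 3 : ℕ) : Cardinal) ≤ Algebra.trdeg ℚ ↥(IntermediateField.adjoin ℚ
      (Set.range (Fin.append (fun j => ((![(1 : ℝ), rhoU, rhoT] j : ℝ) : ℂ))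
          (fun j => ((![(1 : ℝ), rhoU, rhoT] j : ℝ) : ℂ) * Complex.I)) ∪
        Set.range (Complex.exp ∘ Fin.append (fun j => ((![(1 : ℝ), rhoU, rhoT] j : ℝ) : ℂ))
          (fun j => ((![(1 : ℝ), rhoU, rhoT] j : ℝ) : ℂ) * Complex.I)))) :=
  schanuel_body_one_pair sw_mono le_sw ultraLiouvilleSW_rhoU towerLiouville_rhoT

/-- Schanuel's conjecture at `z = (ρ_U, ρ_T, iρ_U, iρ_T)` (`n = 4`) — PROVED. -/
theorem schanuel_body_rhoU_rhoT :
    ((2 + 2 : ℕ) : Cardinal) ≤ Algebra.trdeg ℚ ↥(IntermediateField.adjoin ℚ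
      (Set.range (Fin.append (fun j => ((![rhoU, rhoT] j : ℝ) : ℂ)) (fun j => ((![rhoU, rhoT] j : ℝ) : ℂ) * Complex.I)) ∪
        Set.range (Complex.exp ∘ Fin.append (fun j => ((![rhoU, rhoT] j : ℝ) : ℂ))
          (fun j => ((![rhoU, rhoT] j : ℝ) : ℂ) * Complex.I)))) :=
  schanuel_body_pair sw_mono le_sw ultraLiouvilleSW_rhoU towerLiouville_rhoT

end Cells

end Summit.Schanuel.Schanuel.Theorems.RootDecomp1BProductCell

end
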